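import Mathlib
import Literature.Barriers.ValiantsHypothesis.AlgebraicNaturalProofs
import Summits.ValiantsHypothesis.ValiantsHypothesis.Theorems.BarrierLeverSuccinctHittingSetsForVPSparse
import Summits.ValiantsHypothesis.ValiantsHypothesis.Theorems.BarrierLeverSuccinctHittingSetsForVPDimensionCount
import Summits.ValiantsHypothesis.ValiantsHypothesis.Theorems.BarrierLeverSuccinctHittingSetsForVPStubSeparableCoeff
import Summits.ValiantsHypothesis.ValiantsHypothesis.Theorems.BarrierLeverSuccinctHittingSetsForVPStubSvHit
import Summits.ValiantsHypothesis.ValiantsHypothesis.Theorems.BarrierLeverSuccinctHittingSetsForVPStubLagrangeIndicator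
import Summits.ValiantsHypothesis.ValiantsHypothesis.Theorems.BarrierLeverSuccinctHittingSetsForVPStubGeneratorGlue
import HarnessLib

/-!
# Crux `BarrierLever.SuccinctHittingSetsForVP` (stmt-ValiantsHypothesis-14610), line `registered` —
A SUCCINCT GENERATOR AGAINST SPARSE DISTINGUISHERS, AND PRODUCTS OF SPARSE POLYNOMIALS ARE HIT
(Forbes–Shpilka–Volk 2018 Construction 25/29, Lemma 28/31, Cor. 34 — the generator form — in the
tree's regime `d = n`)

**What is proved (unconditional; structure of the open stub — it strengthens the landed sparse half
`isSuccinctHittingSet_sparse` (p152812) from hitting SET to GENERATOR and does NOT close the item).**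

* `exists_sparseGenerator` (assembly of the four landed wave-2 stubs `stub_separableCoeff` p153631,
  `stub_svHit` p153658, `stub_lagrangeIndicator` p153467, `stub_generatorGlue` p153704): for every
  sparsity exponent `a`, for all `n ≥ n₀(a)`, there is ONE polynomial map
  `Γ : (μ ↦ Γ_μ) ∈ ℂ[W_1..W_t, Z_{1,1}..Z_{t,n}]^{N}`, `t = 2an`, `N = C(2n,n)` — the succinct
  Shpilka–Volkovich generator of FSV Construction 25 in regime `d = n`, shifted (Construction 29) by
  the coefficient vector of the full-support circuit `(1 + Σ x_i)^n`:
  `Γ_μ = coeff_μ f₀ + Σ_{j<t} W_j ∏_i ℓ_{μ_i}(Z_{j,i})`, `ℓ_k` the Lagrange indicators of `{0..n}` —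
  such that (i) every value `Γ(p)`, `p ∈ ℂ^{t + tn}`, is the coefficient vector of some
  `f ∈ SmallCircuits ℂ n 10` (degree `≤ n`, size `≤ n^10`), and (ii) `D ∘ Γ ≠ 0` for every nonzero
  `D` with at most `N^a` monomials. (FSV Cor. 34: "`Q^{SSV}_{n,⌈log s⌉}` is a succinct GENERATOR for
  `s`-sparse polynomials"; compare the landed `succinctHittingSetsForVP_iff_generator` (p148189):
  the CRUX is the same statement with "every nonzero level-one distinguisher" in place of "sparse".)
* `Generator.exists_mem_smallCircuits_of_aeval_ne_zero`, `Generator.isSuccinctHittingSet_of_annihilators`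
  (the generator principle, FSV §3): whatever a realisable map `Γ` does not annihilate is hit; so
  hitting a class `𝒟` reduces to hitting its members that annihilate `Γ`.
* `isSuccinctHittingSet_sparseProducts` (= registered stub `stub_sparseProducts`): since
  `(∏_j E_j) ∘ Γ = ∏_j (E_j ∘ Γ)` and `ℂ[W, Z]` is a domain, `SmallCircuits ℂ n 10` hits, eventually
  in `n`, every nonzero finite PRODUCT of `N^a`-sparse polynomials in the coefficient variables —
  depth-3 `ΠΣΠ` distinguishers with `poly(N)`-sparse factors, of any degree and size; in particular
  `ΠΣ` distinguishers (products of affine forms in the `N` coefficients, each `(N+1)`-sparse):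
  no product of sparse polynomials is an algebraically natural proof against `VP`
  (`not_isNaturalProof_prod_sparse`).
* `aeval_generator_ne_zero_of_prod` : the class of polynomials not annihilating `Γ` is closed under
  products (and contains every nonzero `N^a`-sparse polynomial) — the multiplicative robustness that a
  hitting SET statement lacks.

Proof: FSV's — plant the `≤ t` free coordinates of a sparse shift by specialising `Z_j` to grid
points (Lemma 28; `stub_svHit`), the sparse shift being the one produced by Lemma 32 at the
full-support point (`Sparse.exists_narrow_monomial_shift`); succinctness because a rank-one
coefficient tensor `∏_i c_i(μ_i)` is the coefficient vector of the degree-`≤ n` truncation of a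
product of univariates (`stub_separableCoeff`, size `≤ n⁸`). Axioms: `propext`, `Classical.choice`,
`Quot.sound`. References: [ForbesShpilkaVolk2018] §3 (generators), Construction 25/29, Fact 26/27,
Lemma 28, 31, 32, Cor. 34.
-/

-- layout Summits/ValiantsHypothesis/ValiantsHypothesis forces the duplicated namespace component
set_option linter.dupNamespace false

namespace Summit.ValiantsHypothesis.ValiantsHypothesis.Theorems.BarrierLever.SuccinctHittingSetsForVP

open Literature.Barriers.ValiantsHypothesis Literature.Computability.AlgebraicComplexity MvPolynomial

namespace Generator

variable {n : ℕ}

/-- **The generator principle (FSV §3): what a realisable map does not annihilate is hit.** If every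
value of `Γ` is the coefficient vector of a member of `SmallCircuits ℂ n b` and `D ∘ Γ ≠ 0`, then
`D(coeff f) ≠ 0` for some `f ∈ SmallCircuits ℂ n b`. [cite: ForbesShpilkaVolk2018, §3 (Lemma 3.4)] -/
theorem exists_mem_smallCircuits_of_aeval_ne_zero {b : ℕ} {P : Type*}
    {Γ : degLEMonomials n → MvPolynomial P ℂ}
    (hreal : ∀ p : P → ℂ, ∃ f ∈ SmallCircuits ℂ n b,
      ∀ μ : degLEMonomials n, coeff (μ : Fin n →₀ ℕ) f = eval p (Γ μ))
    {D : MvPolynomial (degLEMonomials n) ℂ} (hD : aeval Γ D ≠ 0) :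
    ∃ f ∈ SmallCircuits ℂ n b, eval (coeffVector (degLEMonomials n) f) D ≠ 0 := by
  obtain ⟨p, hp⟩ : ∃ p, eval p (aeval Γ D) ≠ 0 := by
    by_contra hcon
    push Not at hcon
    exact hD (MvPolynomial.funext fun v => by simpa using hcon v)
  obtain ⟨f, hf, hcoeff⟩ := hreal p
  refine ⟨f, hf, ?_⟩
  rw [LowDegreeEquations.eval_comp_aeval] at hp
  have hv : coeffVector (degLEMonomials n) f = fun μ => eval p (Γ μ) := funext fun μ => hcoeff μ
  rwa [hv]

/-- **Reduction to annihilators.** If `Γ` is realisable in `SmallCircuits ℂ n b₁` and the members of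
`𝒟` annihilating `Γ` are hit by `SmallCircuits ℂ n b₂`, then all of `𝒟` is hit by
`SmallCircuits ℂ n (max b₁ b₂)` (`n ≥ 1`). [cite: ForbesShpilkaVolk2018, §3] -/
theorem isSuccinctHittingSet_of_annihilators {b₁ b₂ : ℕ} (hn : 1 ≤ n) {P : Type*}
    {Γ : degLEMonomials n → MvPolynomial P ℂ}
    (hreal : ∀ p : P → ℂ, ∃ f ∈ SmallCircuits ℂ n b₁,
      ∀ μ : degLEMonomials n, coeff (μ : Fin n →₀ ℕ) f = eval p (Γ μ))
    {𝒟 : Set (MvPolynomial (degLEMonomials n) ℂ)}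
    (hres : IsSuccinctHittingSet (degLEMonomials n) (SmallCircuits ℂ n b₂) (𝒟 ∩ {D | aeval Γ D = 0})) :
    IsSuccinctHittingSet (degLEMonomials n) (SmallCircuits ℂ n (max b₁ b₂)) 𝒟 := by
  intro D hD hD0
  by_cases hann : aeval Γ D = 0
  · obtain ⟨f, hf, hne⟩ := hres D ⟨hD, hann⟩ hD0
    exact ⟨f, smallCircuits_mono ℂ (le_max_right b₁ b₂) hn hf, hne⟩
  · obtain ⟨f, hf, hne⟩ := exists_mem_smallCircuits_of_aeval_ne_zero hreal hann
    exact ⟨f, smallCircuits_mono ℂ (le_max_left b₁ b₂) hn hf, hne⟩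

/-- **Multiplicativity.** A product of polynomials none of which annihilates `Γ` does not annihilate
`Γ` (`ℂ[P]` is a domain). [folklore] -/
theorem aeval_prod_ne_zero {P : Type*} {Γ : degLEMonomials n → MvPolynomial P ℂ} {k : ℕ}
    {E : Fin k → MvPolynomial (degLEMonomials n) ℂ} (hE : ∀ j, aeval Γ (E j) ≠ 0) :
    aeval Γ (∏ j, E j) ≠ 0 := by
  rw [map_prod]
  exact Finset.prod_ne_zero_iff.mpr fun j _ => hE j

end Generator

open Generator

/-- **A succinct generator against sparse distinguishers (FSV Cor. 34, generator form, regime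
`d = n`)** — unconditional assembly of the landed wave-2 stubs: for every `a` there is `n₀` such that
for all `n ≥ n₀` some polynomial map `Γ` in `t + tn` variables (`t = 2an`; the shifted succinct
Shpilka–Volkovich generator) takes ALL its values in `coeff(SmallCircuits ℂ n 10)` and is annihilated
by NO nonzero polynomial with at most `C(2n,n)^a` monomials. [cite: ForbesShpilkaVolk2018, Construction 29 and Cor. 34] -/
theorem exists_sparseGenerator :
    ∀ a : ℕ, ∃ n₀ : ℕ, ∀ n : ℕ, n₀ ≤ n →
      ∃ (t : ℕ) (Γ : degLEMonomials n → MvPolynomial (Fin t ⊕ (Fin t × Fin n)) ℂ),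
        (∀ p : Fin t ⊕ (Fin t × Fin n) → ℂ, ∃ f ∈ SmallCircuits ℂ n 10,
            ∀ μ : degLEMonomials n,
              MvPolynomial.coeff (μ : Fin n →₀ ℕ) f = MvPolynomial.eval p (Γ μ)) ∧
        ∀ D : MvPolynomial (degLEMonomials n) ℂ, D ≠ 0 →
          D.support.card ≤ Nat.choose (2 * n) n ^ a → MvPolynomial.aeval Γ D ≠ 0 :=
  stub_generatorGlue stub_separableCoeff stub_svHit stub_lagrangeIndicator

/-- **Products do not annihilate the generator.** With `Γ` as in `exists_sparseGenerator` at level `a`: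
a finite product of nonzero `N^a`-sparse polynomials does not annihilate `Γ`.
[cite: ForbesShpilkaVolk2018, Cor. 34] -/
theorem aeval_generator_ne_zero_of_prod {n a t : ℕ}
    {Γ : degLEMonomials n → MvPolynomial (Fin t ⊕ (Fin t × Fin n)) ℂ}
    (hhit : ∀ D : MvPolynomial (degLEMonomials n) ℂ, D ≠ 0 →
      D.support.card ≤ Nat.choose (2 * n) n ^ a → aeval Γ D ≠ 0)
    {k : ℕ} {E : Fin k → MvPolynomial (degLEMonomials n) ℂ} (hE0 : ∀ j, E j ≠ 0)
    (hE : ∀ j, (E j).support.card ≤ Nat.choose (2 * n) n ^ a) :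
    aeval Γ (∏ j, E j) ≠ 0 :=
  aeval_prod_ne_zero fun j => hhit (E j) (hE0 j) (hE j)

/-- **Products of sparse polynomials are hit (FSV Cor. 34 in regime `d = n`, multiplicative form).**
For every `a` there is `n₀` such that for all `n ≥ n₀` the coefficient vectors of `SmallCircuits ℂ n 10`
hit every nonzero finite product `∏_j E_j` of polynomials in the `N = C(2n,n)` coefficient variables
with at most `N^a` monomials each — e.g. every `ΠΣ` distinguisher (product of affine forms) and every
depth-3 `ΠΣΠ` distinguisher with `poly(N)`-sparse product gates, of any degree and size.
[cite: ForbesShpilkaVolk2018, Cor. 34] -/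
theorem isSuccinctHittingSet_sparseProducts :
    ∀ a : ℕ, ∃ n₀ : ℕ, ∀ n : ℕ, n₀ ≤ n →
      IsSuccinctHittingSet (degLEMonomials n) (SmallCircuits ℂ n 10)
        {D | ∃ (k : ℕ) (E : Fin k → MvPolynomial (degLEMonomials n) ℂ),
          D = ∏ j, E j ∧ ∀ j, (E j).support.card ≤ Nat.choose (2 * n) n ^ a} := by
  intro a
  obtain ⟨n₀, h⟩ := exists_sparseGenerator a
  refine ⟨n₀, fun n hn => ?_⟩
  obtain ⟨t, Γ, hreal, hhit⟩ := h n hn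
  rintro D ⟨k, E, rfl, hE⟩ hD0
  have hE0 : ∀ j, E j ≠ 0 := fun j h0 => hD0 (Finset.prod_eq_zero (Finset.mem_univ j) h0)
  exact exists_mem_smallCircuits_of_aeval_ne_zero hreal (aeval_generator_ne_zero_of_prod hhit hE0 hE)

/-- **Registered stub `stub_sparseProducts`** (crux stmt-ValiantsHypothesis-14610, line `registered`;
the sparse half of level one in generator / multiplicative form): verbatim
`isSuccinctHittingSet_sparseProducts`. [cite: ForbesShpilkaVolk2018, Cor. 34] -/
theorem stub_sparseProducts :
    ∀ a : ℕ, ∃ n₀ : ℕ, ∀ n : ℕ, n₀ ≤ n →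
      IsSuccinctHittingSet (degLEMonomials n) (SmallCircuits ℂ n 10)
        {D | ∃ (k : ℕ) (E : Fin k → MvPolynomial (degLEMonomials n) ℂ),
          D = ∏ j, E j ∧ ∀ j, (E j).support.card ≤ Nat.choose (2 * n) n ^ a} :=
  isSuccinctHittingSet_sparseProducts

/-- **No product of sparse polynomials is a natural proof against `VP`.** For every `a` and every
`b ≥ 10`, eventually in `n`: no nonzero product of `N^a`-sparse polynomials in the coefficient
variables vanishes on (the coefficient vectors of) all of `SmallCircuits ℂ n b` — whatever the
distinguisher class `𝒟` it is filed under. [cite: ForbesShpilkaVolk2018, Def. 1 and Cor. 34] -/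
theorem not_isNaturalProof_prod_sparse (a : ℕ) : ∃ n₀ : ℕ, ∀ n : ℕ, n₀ ≤ n → ∀ b : ℕ, 10 ≤ b →
    ∀ (𝒟 : Set (MvPolynomial (degLEMonomials n) ℂ)) (k : ℕ)
      (E : Fin k → MvPolynomial (degLEMonomials n) ℂ),
      (∀ j, (E j).support.card ≤ Nat.choose (2 * n) n ^ a) →
        ¬ IsNaturalProof (degLEMonomials n) (SmallCircuits ℂ n b) 𝒟 (∏ j, E j) := by
  obtain ⟨n₀, h⟩ := isSuccinctHittingSet_sparseProducts a
  refine ⟨max n₀ 1, fun n hn b hb 𝒟 k E hE hnat => ?_⟩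
  have hn₀ : n₀ ≤ n := le_trans (le_max_left _ _) hn
  have hn1 : 1 ≤ n := le_trans (le_max_right _ _) hn
  obtain ⟨f, hf, hne⟩ := h n hn₀ (∏ j, E j) ⟨k, E, rfl, hE⟩ hnat.2.1
  exact hne (hnat.2.2 f (smallCircuits_mono ℂ hb hn1 hf))

/-- **Level one reduces to the annihilators of the generator.** For `n ≥ n₀(1)`, with `Γ` the
level-`1` generator of `exists_sparseGenerator`: if the level-one distinguishers ANNIHILATING `Γ` are hit
by `SmallCircuits ℂ n b`, then all level-one distinguishers are hit by `SmallCircuits ℂ n (max 10 b)`.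
(The annihilators of `Γ` contain no nonzero `N`-sparse polynomial and no product of such.)
[cite: ForbesShpilkaVolk2018, §3 and Question 6] -/
theorem levelOne_of_generator_annihilators :
    ∃ n₀ : ℕ, ∀ n : ℕ, n₀ ≤ n →
      ∃ (t : ℕ) (Γ : degLEMonomials n → MvPolynomial (Fin t ⊕ (Fin t × Fin n)) ℂ),
        (∀ D : MvPolynomial (degLEMonomials n) ℂ, D ≠ 0 →
          D.support.card ≤ Nat.choose (2 * n) n → aeval Γ D ≠ 0) ∧
        ∀ b : ℕ, IsSuccinctHittingSet (degLEMonomials n) (SmallCircuits ℂ n b)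
            (Distinguishers ℂ n 1 ∩ {D | aeval Γ D = 0}) →
          IsSuccinctHittingSet (degLEMonomials n) (SmallCircuits ℂ n (max 10 b))
            (Distinguishers ℂ n 1) := by
  obtain ⟨n₀, h⟩ := exists_sparseGenerator 1
  refine ⟨max n₀ 1, fun n hn => ?_⟩
  have hn₀ : n₀ ≤ n := le_trans (le_max_left _ _) hn
  have hn1 : 1 ≤ n := le_trans (le_max_right _ _) hn
  obtain ⟨t, Γ, hreal, hhit⟩ := h n hn₀
  refine ⟨t, Γ, fun D hD0 hD => hhit D hD0 (by simpa only [pow_one] using hD), fun b hres => ?_⟩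
  exact isSuccinctHittingSet_of_annihilators hn1 hreal hres

end Summit.ValiantsHypothesis.ValiantsHypothesis.Theorems.BarrierLever.SuccinctHittingSetsForVP
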